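import Summits.QuantumFields.BalabanUV.Beta.WardLocusRecursive
import Literature.MathematicalPhysics.QuantumFieldTheory.Balaban1983to89.Beta.SecondOrderResponse

/-!
# `BalabanUV.Beta.LagrangeFold` — binder row D1, (L4) bookkeeping: THE Λ-FOLD IDENTITY (the folded Lagrange stencil read through the FIELD rows
# of a kernel's column is minus the MULTIPLIER-column vertex of the sandwich `A∘E∘K`) — `BalabanStepW2`'s informal «ORDER-ONE CONSISTENCY
# READING», generic kernel half
# (β sub-cell, D1 formalisation swarm, unit `b2b-balaban-beta-d1-formalise-leaf-10`, gen 2; CLAIM «D1-L4-FOLD»)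

NOT IN PRINT; OUR BOOKKEEPING.  HONEST FRAMING (cell contract, verbatim): «discharging `BetaPertH` makes Bałaban's UV stability
UNCONDITIONAL — a real constructive-QFT result; it is NOT the continuum limit and NOT the Clay problem.»  HONEST DEPENDENCY (verbatim):
«continuum YM on T⁴ ⇐ BetaPertH ∧ nine spine estimates (0/9 proved); BetaPertH ⇐ (D1) ∧ (D4) ∧ CAP+tail; G-an2-4 gates asym, D1 and
NE2/3/4.»  This module is [folklore] kernel algebra (Fubini + block bookkeeping); it instantiates NO binder of the β-function wall, carries no
`[cite:]` tag, no `def`, no `def … : Prop`, and is NOT D1, NOT `BetaPertH`, NOT continuum, NOT Clay.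

## What and why

The first-order tables of the wall literal v2.26 (`WardLocusRecursive.SrecAt`, `SpineRootedS0N.S0NAt`) carry the multiplier's first
response FOLDED into the field stencil: their Lagrange piece is `c • SLam N (lamCoeffK A E N) Q` — `InterLevelTransport.SLam`, the
conversion coefficients `BalabanStepJetsSucc.lamCoeffK A E N μ y κ′ u′ = (A∘E)((N•y, inr μ); (u′, inl κ′))` — and the one-step kernel reads
it through the FIELD rows `colH K` of the `(μ, y)`-column of its propagator `K` (`OneStepKernelFamily.vertexOfK`).  an2's second-order
carrier (`SecondOrderResponse.dM = vertexOfK + vertexOfM`) reads a multiplier table through the MULTIPLIER rows `colM K` instead.  The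
design record (`BalabanStepW2`, «THE ORDER-ONE CONSISTENCY READING», informal there; an2-g16 `SKELETON-D1-L4.v0` §3 (W-T) «to be made a
lemma»; an1-g27 condition (c1)) needs the two readings to AGREE at order one.  This file proves the generic half, with NO resolvent
identity used:

* §1 `colM_comp_comp_eq` — for `E` free of multiplier columns (`∀ v u h ν, E v u h (inr ν) = 0`; every `mmRead`-type kernel, in particular
  `BalabanStepJetsSucc.E2 d Lc j`, qualifies: `E2_inr_col`), the multiplier column of the sandwich is the fold of the field column:
  `colM (A∘E∘K) N μ y ρ w = Σ'_u Σ_κ lamCoeffK A E N ρ w κ u · colH K N μ y κ u`.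
* §2 `prodBound_fold` — the product majorant making the `(u, w)` double series absolutely convergent (decay of `K` and of `A∘E`).
* §3 **`vertexOfK_SLam_lamCoeffK`** — THE Λ-FOLD IDENTITY:
  `vertexOfK K N (SLam N (lamCoeffK A E N) Q) μ y = −vertexOfM (comp (comp A E) K) N Q μ y`
  for decaying `K`, decaying `A∘E`, `E` free of multiplier columns, and any uniformly bounded coarse-bond table `Q`; and its scaled form
  `vertexOfK_smul_SLam_lamCoeffK` (the Λ-piece `c • SLam …` as it literally occurs in `SrecAt`/`S0NAt`-type tables).

CONSEQUENCE (stated, not proved here — the resolvent half is the sequel `LagrangeFoldStep`): with `K = A = G_j` a relative inverse of the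
bordered step operator `𝕄_j` whose field block is `wVH j • E2 j` and whose multiplier block is `0`, the KKT block identity
`(G∘𝕄_ff∘G)_mm = −G_mm` turns the right-hand side into `+(c / wVH j) • vertexOfM G_j N Q`, i.e. the folded chart and the Lagrangian chart
agree at order one with multiplier weight `cΛ·wΛ j / wVH j` and a PLUS sign (the minus of `SLam` and the KKT minus cancel).  For the
CURRENT typing of `SrecAt` (conversion coefficients through the STRAIGHT `KInvStep Lc j`, vertex through the co-dressed `G_j`) the sandwich
is the mixed `KInvStep_j ∘ E2_j ∘ G_j` — an2's OPEN TYPING POINT (Λ-slot); this file is agnostic.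
-/

noncomputable section

open Finset
open scoped BigOperators
open Literature.MathematicalPhysics.QuantumFieldTheory
open Literature.MathematicalPhysics.QuantumFieldTheory.Balaban1983to89
open Literature.MathematicalPhysics.QuantumFieldTheory.Balaban1983to89.Beta
open B12Sec2to5 (l1 l1_nonneg)
open ExpKernelCalculus (MKer Decays comp summable_exp_shift' l1_sub_triangle)
open KernelWard (ProdBound tsum_comm_of_prodBound)
open OneStepResolventKernel (Fib wsum decays_mono)
open OneStepKernelFamily (colH vertexOfK abs_colH_le)
open InterLevelTransport (SLam cwsum cwsum_apply)
open BalabanStepJetsSucc (lamCoeffK E2 mmRead)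
open SecondOrderResponse (colM vertexOfM)

namespace Summit.QuantumFields.BalabanUV.Beta.LagrangeFold

variable {d : ℕ} {N : ℕ}

/-! ## §1 The multiplier column of a sandwich `A∘E∘K` is the Λ-fold of the field column of `K` -/

/-- [folklore] A kernel FREE OF MULTIPLIER COLUMNS kills the multiplier legs of anything composed onto it from the left:
`(A∘E)(x, u)(a, inr ν) = 0`. -/
theorem comp_inr_col_eq_zero {A E : MKer (d + 1) (Fib d)} (hE : ∀ v u (h : Fib d) (ν : Fin (d + 1)), E v u h (Sum.inr ν) = 0)
    (x u : Fin (d + 1) → ℤ) (a : Fib d) (ν : Fin (d + 1)) : comp A E x u a (Sum.inr ν) = 0 := by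
  unfold ExpKernelCalculus.comp
  simp only [hE, mul_zero, Finset.sum_const_zero, tsum_zero]

/-- [folklore] `mmRead M F` has no multiplier columns. -/
theorem mmRead_inr_col (M : ℕ) (F : MKer (d + 1) (Fib d)) (v u : Fin (d + 1) → ℤ) (h : Fib d) (ν : Fin (d + 1)) :
    mmRead M F v u h (Sum.inr ν) = 0 := by
  cases h <;> rfl

/-- [folklore] `E2 d Lc j` has no multiplier columns. -/
theorem E2_inr_col (Lc : ℕ) [NeZero Lc] (j : ℕ) (v u : Fin (d + 1) → ℤ) (h : Fib d) (ν : Fin (d + 1)) :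
    E2 d Lc j v u h (Sum.inr ν) = 0 :=
  mmRead_inr_col _ _ v u h ν

/-- [folklore] **THE MULTIPLIER COLUMN OF THE SANDWICH IS THE Λ-FOLD OF THE FIELD COLUMN.**  For `E` free of multiplier columns:
`colM (A∘E∘K) N μ y ρ w = Σ'_u Σ_κ lamCoeffK A E N ρ w κ u · colH K N μ y κ u` (pointwise bookkeeping: `comp` unfolds, the sum over the
packed fibre splits into field legs — the fold — and multiplier legs — zero by `comp_inr_col_eq_zero`). -/
theorem colM_comp_comp_eq {A E K : MKer (d + 1) (Fib d)} (hE : ∀ v u (h : Fib d) (ν : Fin (d + 1)), E v u h (Sum.inr ν) = 0)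
    (μ : Fin (d + 1)) (y : Fin (d + 1) → ℤ) (ρ : Fin (d + 1)) (w : Fin (d + 1) → ℤ) :
    colM (comp (comp A E) K) N μ y ρ w = ∑' u, ∑ κ : Fin (d + 1), lamCoeffK A E N ρ w κ u * colH K N μ y κ u := by
  simp only [colM]
  rw [show comp (comp A E) K = fun x z a b => ∑' u, ∑ f : Fib d, comp A E x u a f * K u z f b from rfl]
  refine tsum_congr fun u => ?_
  rw [Fintype.sum_sum_type]
  simp only [comp_inr_col_eq_zero hE, zero_mul, Finset.sum_const_zero, add_zero]
  rfl

/-! ## §2 The product majorant of the fold -/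

/-- [folklore] THE EXPONENT SPLIT of the fold: `e^{−δ|u−p|}·e^{−δ|q−u|} ≤ e^{−(δ/2)|u−p|}·e^{−(δ/2)|q−p|}` (`|q − p| ≤ |q − u| + |u − p|`). -/
theorem exp_fold_split {δ : ℝ} (hδ : 0 ≤ δ) (u p q : Fin (d + 1) → ℤ) :
    Real.exp (-δ * l1 (u - p)) * Real.exp (-δ * l1 (q - u)) ≤ Real.exp (-(δ / 2) * l1 (u - p)) * Real.exp (-(δ / 2) * l1 (q - p)) := by
  rw [← Real.exp_add, ← Real.exp_add]
  apply Real.exp_le_exp.mpr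
  have h1 := l1_sub_triangle q u p
  have h2 := l1_nonneg (q - u)
  have h3 := l1_nonneg (u - p)
  nlinarith

/-- [folklore] Block positions are summable against a decaying weight: `w ↦ e^{−c|N•w − p|}` is summable (`w ↦ N•w` is injective). -/
theorem summable_exp_zsmul [NeZero N] {c : ℝ} (hc : 0 < c) (p : Fin (d + 1) → ℤ) :
    Summable fun w : Fin (d + 1) → ℤ => Real.exp (-c * l1 ((N : ℤ) • w - p)) := by
  have hN : (N : ℤ) ≠ 0 := by exact_mod_cast NeZero.ne N
  have hinj : Function.Injective fun w : Fin (d + 1) → ℤ => (N : ℤ) • w := smul_right_injective _ hN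
  exact (summable_exp_shift' hc p).comp_injective hinj

/-- [folklore] **THE PRODUCT MAJORANT OF THE FOLD**: for a weight `a` decaying from `p`, coefficients `b w u` decaying from the block
position `N•w`, and a bounded scalar family `q w`, the double family `(u, w) ↦ a u · (b w u · q w)` has a product majorant (so Fubini holds
and all slices are summable, `KernelWard.ProdBound.summable`). -/
theorem prodBound_fold [NeZero N] {a : (Fin (d + 1) → ℤ) → ℝ} {b : (Fin (d + 1) → ℤ) → (Fin (d + 1) → ℤ) → ℝ} {q : (Fin (d + 1) → ℤ) → ℝ}
    {Ca Cb B δ : ℝ} (hδ : 0 < δ) {p : Fin (d + 1) → ℤ} (ha : ∀ u, |a u| ≤ Ca * Real.exp (-δ * l1 (u - p)))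
    (hb : ∀ w u, |b w u| ≤ Cb * Real.exp (-δ * l1 ((N : ℤ) • w - u))) (hq : ∀ w, |q w| ≤ B) :
    ProdBound fun u w => a u * (b w u * q w) := by
  have hCa : ∀ u, |a u| ≤ |Ca| * Real.exp (-δ * l1 (u - p)) := fun u =>
    (ha u).trans (mul_le_mul_of_nonneg_right (le_abs_self _) (Real.exp_pos _).le)
  have hCb : ∀ w u, |b w u| ≤ |Cb| * Real.exp (-δ * l1 ((N : ℤ) • w - u)) := fun w u =>
    (hb w u).trans (mul_le_mul_of_nonneg_right (le_abs_self _) (Real.exp_pos _).le)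
  have hB : ∀ w, |q w| ≤ |B| := fun w => (hq w).trans (le_abs_self _)
  refine ⟨fun u => (|Ca| * |Cb| * |B|) * Real.exp (-(δ / 2) * l1 (u - p)), fun w => Real.exp (-(δ / 2) * l1 ((N : ℤ) • w - p)),
    (summable_exp_shift' (half_pos hδ) p).mul_left _, summable_exp_zsmul (half_pos hδ) p, fun u => by positivity,
    fun w => (Real.exp_pos _).le, fun u w => ?_⟩
  rw [abs_mul, abs_mul]
  calc |a u| * (|b w u| * |q w|)
      ≤ (|Ca| * Real.exp (-δ * l1 (u - p))) * ((|Cb| * Real.exp (-δ * l1 ((N : ℤ) • w - u))) * |B|) :=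
        mul_le_mul (hCa u) (mul_le_mul (hCb w u) (hB w) (abs_nonneg _) (by positivity)) (by positivity) (by positivity)
    _ = (|Ca| * |Cb| * |B|) * (Real.exp (-δ * l1 (u - p)) * Real.exp (-δ * l1 ((N : ℤ) • w - u))) := by ring
    _ ≤ (|Ca| * |Cb| * |B|) * (Real.exp (-(δ / 2) * l1 (u - p)) * Real.exp (-(δ / 2) * l1 ((N : ℤ) • w - p))) :=
        mul_le_mul_of_nonneg_left (exp_fold_split hδ.le u p _) (by positivity)
    _ = _ := by ring

/-! ## §3 The Λ-fold identity -/

/-- [folklore] **THE Λ-FOLD IDENTITY.**  For a decaying kernel `K`, kernels `A`, `E` with `A∘E` decaying and `E` free of multiplier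
columns, and a uniformly bounded coarse-bond table `Q`:
`vertexOfK K N (SLam N (lamCoeffK A E N) Q) μ y = −vertexOfM (comp (comp A E) K) N Q μ y`
— the folded Lagrange stencil `S^Λ = −Σ_ρ cwsum (lamCoeffK A E N ρ · κ u) (Q ρ)` read through the FIELD rows of the `(μ, y)`-column of `K`
is minus the multiplier-column vertex of the sandwich `A∘E∘K` against the same table.  (Fubini on the product majorant of §2, the fold of
§1; no resolvent identity is used.) -/
theorem vertexOfK_SLam_lamCoeffK [NeZero N] {K A E : MKer (d + 1) (Fib d)} (hK : ∃ δ C : ℝ, 0 < δ ∧ 0 ≤ C ∧ Decays K C δ)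
    (hAE : ∃ δ C : ℝ, 0 < δ ∧ 0 ≤ C ∧ Decays (comp A E) C δ) (hE : ∀ v u (h : Fib d) (ν : Fin (d + 1)), E v u h (Sum.inr ν) = 0)
    {Q : Fin (d + 1) → (Fin (d + 1) → ℤ) → MKer (d + 1) (Fib d)} {B : ℝ} (hQ : ∀ ρ w x z a b, |Q ρ w x z a b| ≤ B)
    (μ : Fin (d + 1)) (y : Fin (d + 1) → ℤ) :
    vertexOfK K N (SLam N (lamCoeffK A E N) Q) μ y = -vertexOfM (comp (comp A E) K) N Q μ y := by
  obtain ⟨δK, CK, hδK, hCK, hKd⟩ := hK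
  obtain ⟨δA, CA, hδA, hCA, hAd⟩ := hAE
  -- a common rate
  set δ := min δK δA with hδdef
  have hδ : 0 < δ := lt_min hδK hδA
  have hKd' : Decays K CK δ := decays_mono hKd hCK le_rfl (min_le_left _ _)
  have hAd' : Decays (comp A E) CA δ := decays_mono hAd hCA le_rfl (min_le_right _ _)
  funext x z a b
  -- the double family, per (κ, ρ)
  set G : Fin (d + 1) → Fin (d + 1) → (Fin (d + 1) → ℤ) → (Fin (d + 1) → ℤ) → ℝ :=
    fun κ ρ u w => colH K N μ y κ u * (lamCoeffK A E N ρ w κ u * Q ρ w x z a b) with hG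
  have hPB : ∀ κ ρ, ProdBound (G κ ρ) := fun κ ρ =>
    prodBound_fold (N := N) hδ (p := (N : ℤ) • y) (fun u => abs_colH_le (N := N) hKd' μ y κ u)
      (fun w u => hAd' ((N : ℤ) • w) u (Sum.inr ρ) (Sum.inl κ)) (fun w => hQ ρ w x z a b)
  have hS1 : ∀ κ ρ u, Summable fun w => G κ ρ u w := fun κ ρ u => ((hPB κ ρ).summable).2.1 u
  have hS2 : ∀ κ ρ w, Summable fun u => G κ ρ u w := fun κ ρ w => ((hPB κ ρ).summable).2.2 w
  have hS3 : ∀ κ ρ, Summable fun u => ∑' w, G κ ρ u w := fun κ ρ => ((hPB κ ρ).summable).1.prod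
  have hS4 : ∀ κ ρ, Summable fun w => ∑' u, G κ ρ u w := fun κ ρ => ((hPB κ ρ).summable).1.prod_symm.prod
  -- left-hand side
  have lhs : vertexOfK K N (SLam N (lamCoeffK A E N) Q) μ y x z a b = -∑ κ, ∑ ρ, ∑' w, ∑' u, G κ ρ u w := by
    simp only [vertexOfK, OneStepResolventKernel.wsum, SLam, cwsum_apply]
    rw [← Finset.sum_neg_distrib]
    refine Finset.sum_congr rfl fun κ _ => ?_
    have e1 : ∀ u, colH K N μ y κ u * -∑ ρ, ∑' w, lamCoeffK A E N ρ w κ u * Q ρ w x z a b = -∑ ρ, ∑' w, G κ ρ u w := by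
      intro u
      rw [mul_neg, Finset.mul_sum]
      refine congrArg Neg.neg (Finset.sum_congr rfl fun ρ _ => ?_)
      rw [← tsum_mul_left]
    simp only [e1, tsum_neg]
    rw [Summable.tsum_finsetSum (fun ρ _ => hS3 κ ρ)]
    refine congrArg Neg.neg (Finset.sum_congr rfl fun ρ _ => ?_)
    exact tsum_comm_of_prodBound (hPB κ ρ)
  -- right-hand side
  have rhs : (-vertexOfM (comp (comp A E) K) N Q μ y) x z a b = -∑ ρ, ∑ κ, ∑' w, ∑' u, G κ ρ u w := by
    simp only [Pi.neg_apply, vertexOfM, cwsum_apply]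
    refine congrArg Neg.neg (Finset.sum_congr rfl fun ρ _ => ?_)
    have e2 : ∀ w, colM (comp (comp A E) K) N μ y ρ w * Q ρ w x z a b = ∑ κ, ∑' u, G κ ρ u w := by
      intro w
      rw [colM_comp_comp_eq (N := N) hE μ y ρ w, ← tsum_mul_right]
      have e3 : ∀ u, (∑ κ, lamCoeffK A E N ρ w κ u * colH K N μ y κ u) * Q ρ w x z a b = ∑ κ, G κ ρ u w := by
        intro u
        rw [Finset.sum_mul]
        exact Finset.sum_congr rfl fun κ _ => by simp only [hG]; ring
      simp only [e3]
      exact Summable.tsum_finsetSum (fun κ _ => hS2 κ ρ w)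
    simp only [e2]
    exact Summable.tsum_finsetSum (fun κ _ => hS4 κ ρ)
  rw [lhs, rhs, Finset.sum_comm]

/-- [folklore] **THE Λ-FOLD IDENTITY, SCALED** — the Lagrange piece exactly as it occurs in the folded first-order tables
(`(cΛ·wΛ j) • SLam N (lamCoeffK A E N) Q κ u`):
`vertexOfK K N (κ u ↦ c • SLam N (lamCoeffK A E N) Q κ u) μ y = −(c • vertexOfM (comp (comp A E) K) N Q μ y)`. -/
theorem vertexOfK_smul_SLam_lamCoeffK [NeZero N] {K A E : MKer (d + 1) (Fib d)} (hK : ∃ δ C : ℝ, 0 < δ ∧ 0 ≤ C ∧ Decays K C δ)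
    (hAE : ∃ δ C : ℝ, 0 < δ ∧ 0 ≤ C ∧ Decays (comp A E) C δ) (hE : ∀ v u (h : Fib d) (ν : Fin (d + 1)), E v u h (Sum.inr ν) = 0)
    {Q : Fin (d + 1) → (Fin (d + 1) → ℤ) → MKer (d + 1) (Fib d)} {B : ℝ} (hQ : ∀ ρ w x z a b, |Q ρ w x z a b| ≤ B) (c : ℝ)
    (μ : Fin (d + 1)) (y : Fin (d + 1) → ℤ) :
    vertexOfK K N (fun κ u => c • SLam N (lamCoeffK A E N) Q κ u) μ y = -(c • vertexOfM (comp (comp A E) K) N Q μ y) := by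
  have h := vertexOfK_SLam_lamCoeffK (N := N) hK hAE hE hQ μ y
  have hsm : vertexOfK K N (fun κ u => c • SLam N (lamCoeffK A E N) Q κ u) μ y = c • vertexOfK K N (SLam N (lamCoeffK A E N) Q) μ y := by
    funext x z a b
    simp only [vertexOfK, OneStepResolventKernel.wsum, Pi.smul_apply, smul_eq_mul, Finset.mul_sum]
    refine Finset.sum_congr rfl fun κ _ => ?_
    rw [← tsum_mul_left]
    exact tsum_congr fun u => by ring
  rw [hsm, h, smul_neg]

end Summit.QuantumFields.BalabanUV.Beta.LagrangeFold

end
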